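import Summits.ValiantsHypothesis.ValiantsHypothesis.Theorems.SymPencilSdcSuperquadraticStubDefectForm
import Summits.ValiantsHypothesis.ValiantsHypothesis.Theorems.SymPencilPerFourCoordinateRadical

/-!
# Route `SymPencil` — the ladder past `sdc(per_4) ≥ 21`: sizes `22 … 25` reduced to two
# statements about `7`- and `6`-dimensional subspaces of `Sing Z(per_4)`
# (`--supports` stmt-ValiantsHypothesis-5674 `SdcSuperquadratic`; rung currency only)

The kernel package of a symmetric affine determinantal representation of `per_4` of size `m`
(`SymPencilSdcSuperquadraticStubDefectForm.kernel_package_of_isSymm_isAffineDetRepr_perPoly_four`,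
prover val-width-5674-p2): `V ⊆ Sing Z(per_4)`, `dim V + r = 16`, `2r + 1 ≤ m`, `dim V ≤ 8`, and for
every base point `u` the `s²`-coefficient of `per_4 (u + s y)` along `V` is a sum of `d = m − 1 − 2r`
weighted squares of linear forms (weights independent of `u`).  The ENGINE `le_of_noSqFamily` runs
the case analysis on `r` for a target size `n ≤ 25`:

* `r = 8` (`dim V = 8`, `d = m − 17 ≤ 7`): `V` is a two-row / two-column block
  (`SymPencilBoxFourEquality.two_rows_or_two_cols`) and the quantitative radical bound
  `2 dim V ≤ d + 8` (`SymPencilPerFourCoordinateRadical`) is violated — this is where `n ≤ 25` is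
  used and where the method saturates (`m = 25`, `d = 8` passes the bound);
* `r = 9` (`dim V = 7`, `d = m − 19`): the hypothesis `H7` — NO `7`-dimensional `V ⊆ Sing Z(per_4)`
  carries an `(n − 20)`-square family;
* `r = 10` (`dim V = 6`, `d = m − 21`): the hypothesis `H6` — the same with `6` and `n − 22`;
* `r = 11` (`dim V = 5`, `d = m − 23 ≤ 1`): impossible by the landed affine / one-square lemmas
  (`SymPencilPerFourBlocks.finrank_le_four_of_affine`, `SymPencilPerFourBlocksSq.finrank_le_four_of_sq`),
  which also discharge `H6` for `n ≤ 23` and `H7` for `n ≤ 21` (`not_sqFamily_fin_zero/one`).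

Consequences (all over any field of characteristic `0`): `sdc(per_4) ≥ 22 ⟸ H7₂`
(`twentyTwo_le_of_seven`), `≥ 23 ⟸ H7₃` (`twentyThree_le_of_seven`), `≥ 24 ⟸ H7₄ ∧ H6₂`,
`≥ 25 ⟸ H7₅ ∧ H6₃` (`twentyFour_le_of`, `twentyFive_le_of`), where `H7ₖ` / `H6ₖ` say that no `7`- /
`6`-dimensional subspace of `Sing Z(per_4)` has, for some fixed weights, a `k`-square expansion of
the `s²`-coefficient at every base point.  Inside a two-row / two-column block `H7ₖ` (`k ≤ 5`) and
`H6ₖ` (`k ≤ 3`) already hold (`SymPencilPerFourCoordinateRadical`); what is OPEN is the list of `7`-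
and `6`-dimensional subspaces of `Sing Z(per_4)` NOT inside a block (e.g. the `7`-dimensional
crosses `row a ∪ column c`) and their ranks — the "(9,7) wall" of the line card.  The rung `n = 21`
of the engine is the line's target `SdcPerFourTwentyOne` (assembled by val-width-5674-p2, not here).

Honest framing: conditional reductions and two unconditional small cases; no new lower bound is
claimed here, the crux `SdcSuperquadratic` stays open, `VP ≠ VNP` is not moved.  No definitions,
no named facts. [folklore]
-/

noncomputable section

-- single-conjunct layout: Sub = Summit, duplicated namespace component intended
set_option linter.dupNamespace false

namespace Summit.ValiantsHypothesis.ValiantsHypothesis.Theorems.SymPencilSdcPerFourLadder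

open MvPolynomial Module
open Literature.Computability.AlgebraicComplexity
open Summit.ValiantsHypothesis.ValiantsHypothesis.Theorems.SymPencilPerFourBlocks
open Summit.ValiantsHypothesis.ValiantsHypothesis.Theorems.SymPencilPerFourBlocksSq
open Summit.ValiantsHypothesis.ValiantsHypothesis.Theorems.SymPencilBoxFourEquality
open Summit.ValiantsHypothesis.ValiantsHypothesis.Theorems.SymPencilSdcSuperquadraticStubDefectForm
open Summit.ValiantsHypothesis.ValiantsHypothesis.Theorems.SymPencilPerFourCoordinateRadical

variable {K : Type*} [Field K] [CharZero K]

/-- A `0`-square family means `per_4` is affine along `V` at every base point, which forces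
`dim V ≤ 4` (`finrank_le_four_of_affine`); so no `V` of dimension `≥ 5` has one. [folklore] -/
theorem not_sqFamily_fin_zero (V : Submodule K (Fin 4 × Fin 4 → K)) (hV : 5 ≤ finrank K V)
    (c : Fin 0 → K) :
    ¬ (∀ u : Fin 4 × Fin 4 → K, ∃ Λ : Fin 0 → ((Fin 4 × Fin 4 → K) →ₗ[K] K),
        ∀ y ∈ V, ∃ e₀ e₁ : K, ∀ s : K,
          eval (u + s • y) (perPoly (Fin 4) K) = e₀ + s * e₁ + s ^ 2 * ∑ k, c k * (Λ k y) ^ 2) := by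
  intro h
  have h4 : finrank K V ≤ 4 := by
    refine finrank_le_four_of_affine V fun u y hy => ?_
    obtain ⟨Λ, hΛ⟩ := h u
    obtain ⟨e₀, e₁, he⟩ := hΛ y hy
    refine ⟨e₀, e₁, fun s => ?_⟩
    rw [he s]
    simp
  omega

/-- A `1`-square family forces `dim V ≤ 4` (`finrank_le_four_of_sq`); so no `V` of dimension `≥ 5`
has one. [folklore] -/
theorem not_sqFamily_fin_one (V : Submodule K (Fin 4 × Fin 4 → K)) (hV : 5 ≤ finrank K V)
    (c : Fin 1 → K) :
    ¬ (∀ u : Fin 4 × Fin 4 → K, ∃ Λ : Fin 1 → ((Fin 4 × Fin 4 → K) →ₗ[K] K),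
        ∀ y ∈ V, ∃ e₀ e₁ : K, ∀ s : K,
          eval (u + s • y) (perPoly (Fin 4) K) = e₀ + s * e₁ + s ^ 2 * ∑ k, c k * (Λ k y) ^ 2) := by
  intro h
  have h4 : finrank K V ≤ 4 := by
    refine finrank_le_four_of_sq V (c 0) fun u => ?_
    obtain ⟨Λ, hΛ⟩ := h u
    refine ⟨Λ 0, fun y hy => ?_⟩
    obtain ⟨e₀, e₁, he⟩ := hΛ y hy
    refine ⟨e₀, e₁, fun s => ?_⟩
    rw [he s, Fin.sum_univ_one]
  omega

/-- **The ladder engine.**  Let `n ≤ 25`, `n ≤ k₇ + 20`, `n ≤ k₆ + 22`.  If no `7`-dimensional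
subspace of `Sing Z(per_4)` carries a `k₇`-square family and no `6`-dimensional one carries a
`k₆`-square family (fixed weights, every base point), then every symmetric affine determinantal
representation of `per_4` has size `≥ n`.  (The `dim V = 8` case is closed by the BoxFour
classification and the quantitative radical bound; `dim V = 5` by the affine / one-square lemmas.)
[folklore] -/
theorem le_of_noSqFamily (n k₇ k₆ : ℕ) (hn : n ≤ 25) (h7 : n ≤ k₇ + 20) (h6 : n ≤ k₆ + 22)
    (H7 : ∀ V : Submodule K (Fin 4 × Fin 4 → K),
      (∀ x ∈ V, ∀ (r c : Fin 3 → Fin 4), Function.Injective r → Function.Injective c →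
        ((Matrix.of fun i j => x (i, j)).submatrix r c).permanent = 0) →
      finrank K V = 7 → ∀ c : Fin k₇ → K,
      ¬ (∀ u : Fin 4 × Fin 4 → K, ∃ Λ : Fin k₇ → ((Fin 4 × Fin 4 → K) →ₗ[K] K),
          ∀ y ∈ V, ∃ e₀ e₁ : K, ∀ s : K,
            eval (u + s • y) (perPoly (Fin 4) K) = e₀ + s * e₁ + s ^ 2 * ∑ k, c k * (Λ k y) ^ 2))
    (H6 : ∀ V : Submodule K (Fin 4 × Fin 4 → K),
      (∀ x ∈ V, ∀ (r c : Fin 3 → Fin 4), Function.Injective r → Function.Injective c →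
        ((Matrix.of fun i j => x (i, j)).submatrix r c).permanent = 0) →
      finrank K V = 6 → ∀ c : Fin k₆ → K,
      ¬ (∀ u : Fin 4 × Fin 4 → K, ∃ Λ : Fin k₆ → ((Fin 4 × Fin 4 → K) →ₗ[K] K),
          ∀ y ∈ V, ∃ e₀ e₁ : K, ∀ s : K,
            eval (u + s • y) (perPoly (Fin 4) K) = e₀ + s * e₁ + s ^ 2 * ∑ k, c k * (Λ k y) ^ 2))
    {m : ℕ} {A : Matrix (Fin m) (Fin m) (MvPolynomial (Fin 4 × Fin 4) K)} (hS : A.IsSymm)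
    (hA : IsAffineDetRepr (perPoly (Fin 4) K) A) : n ≤ m := by
  by_contra hlt
  push Not at hlt
  obtain ⟨r, V, hVr, h2r, hV8, hSing, hfam⟩ :=
    kernel_package_of_isSymm_isAffineDetRepr_perPoly_four K hS hA
  have hr : r = 8 ∨ r = 9 ∨ r = 10 ∨ r = 11 ∨ 12 ≤ r := by omega
  rcases hr with rfl | rfl | rfl | rfl | h12
  · -- `dim V = 8`: block, and `2·8 ≤ (m − 17) + 8` fails for `m ≤ 24`
    obtain ⟨c, hc⟩ := hfam (m - 17) (by omega)
    have hblock := two_rows_or_two_cols V hSing (by omega)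
    have h := two_mul_finrank_le_card_add_eight_of_sq_family V hblock fun u => by
      obtain ⟨Λ, hΛ⟩ := hc u
      exact ⟨c, Λ, hΛ⟩
    rw [Fintype.card_fin] at h
    omega
  · -- `dim V = 7`: the hypothesis `H7` with `k₇` squares (`m ≤ 19 + k₇`)
    obtain ⟨c, hc⟩ := hfam k₇ (by omega)
    exact H7 V hSing (by omega) c hc
  · -- `dim V = 6`: the hypothesis `H6` with `k₆` squares (`m ≤ 21 + k₆`)
    obtain ⟨c, hc⟩ := hfam k₆ (by omega)
    exact H6 V hSing (by omega) c hc
  · -- `dim V = 5`, `23 ≤ m ≤ 24`: `0` or `1` square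
    have hV5 : 5 ≤ finrank K V := by omega
    rcases (by omega : m = 23 ∨ m = 24) with rfl | rfl
    · obtain ⟨c, hc⟩ := hfam 0 (by omega)
      exact not_sqFamily_fin_zero V hV5 c hc
    · obtain ⟨c, hc⟩ := hfam 1 (by omega)
      exact not_sqFamily_fin_one V hV5 c hc
  · omega

/-- **`sdc(per_4) ≥ 22 ⟸ H7₂`**: if no `7`-dimensional subspace of `Sing Z(per_4)` carries a
two-square family of `s²`-coefficients (fixed weights, every base point), then every symmetric
affine determinantal representation of `per_4` has size `≥ 22`.  (`H6₀` is discharged by the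
affine lemma.) [folklore] -/
theorem twentyTwo_le_of_seven
    (H7 : ∀ V : Submodule K (Fin 4 × Fin 4 → K),
      (∀ x ∈ V, ∀ (r c : Fin 3 → Fin 4), Function.Injective r → Function.Injective c →
        ((Matrix.of fun i j => x (i, j)).submatrix r c).permanent = 0) →
      finrank K V = 7 → ∀ c : Fin 2 → K,
      ¬ (∀ u : Fin 4 × Fin 4 → K, ∃ Λ : Fin 2 → ((Fin 4 × Fin 4 → K) →ₗ[K] K),
          ∀ y ∈ V, ∃ e₀ e₁ : K, ∀ s : K,
            eval (u + s • y) (perPoly (Fin 4) K) = e₀ + s * e₁ + s ^ 2 * ∑ k, c k * (Λ k y) ^ 2))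
    {m : ℕ} {A : Matrix (Fin m) (Fin m) (MvPolynomial (Fin 4 × Fin 4) K)} (hS : A.IsSymm)
    (hA : IsAffineDetRepr (perPoly (Fin 4) K) A) : 22 ≤ m :=
  le_of_noSqFamily 22 2 0 (by norm_num) (by norm_num) (by norm_num) H7
    (fun V _ hV c => not_sqFamily_fin_zero V (by omega) c) hS hA

/-- **`sdc(per_4) ≥ 23 ⟸ H7₃`** (`H6₁` is discharged by the one-square lemma). [folklore] -/
theorem twentyThree_le_of_seven
    (H7 : ∀ V : Submodule K (Fin 4 × Fin 4 → K),
      (∀ x ∈ V, ∀ (r c : Fin 3 → Fin 4), Function.Injective r → Function.Injective c →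
        ((Matrix.of fun i j => x (i, j)).submatrix r c).permanent = 0) →
      finrank K V = 7 → ∀ c : Fin 3 → K,
      ¬ (∀ u : Fin 4 × Fin 4 → K, ∃ Λ : Fin 3 → ((Fin 4 × Fin 4 → K) →ₗ[K] K),
          ∀ y ∈ V, ∃ e₀ e₁ : K, ∀ s : K,
            eval (u + s • y) (perPoly (Fin 4) K) = e₀ + s * e₁ + s ^ 2 * ∑ k, c k * (Λ k y) ^ 2))
    {m : ℕ} {A : Matrix (Fin m) (Fin m) (MvPolynomial (Fin 4 × Fin 4) K)} (hS : A.IsSymm)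
    (hA : IsAffineDetRepr (perPoly (Fin 4) K) A) : 23 ≤ m :=
  le_of_noSqFamily 23 3 1 (by norm_num) (by norm_num) (by norm_num) H7
    (fun V _ hV c => not_sqFamily_fin_one V (by omega) c) hS hA

/-- **`sdc(per_4) ≥ 24 ⟸ H7₄ ∧ H6₂`.** [folklore] -/
theorem twentyFour_le_of
    (H7 : ∀ V : Submodule K (Fin 4 × Fin 4 → K),
      (∀ x ∈ V, ∀ (r c : Fin 3 → Fin 4), Function.Injective r → Function.Injective c →
        ((Matrix.of fun i j => x (i, j)).submatrix r c).permanent = 0) →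
      finrank K V = 7 → ∀ c : Fin 4 → K,
      ¬ (∀ u : Fin 4 × Fin 4 → K, ∃ Λ : Fin 4 → ((Fin 4 × Fin 4 → K) →ₗ[K] K),
          ∀ y ∈ V, ∃ e₀ e₁ : K, ∀ s : K,
            eval (u + s • y) (perPoly (Fin 4) K) = e₀ + s * e₁ + s ^ 2 * ∑ k, c k * (Λ k y) ^ 2))
    (H6 : ∀ V : Submodule K (Fin 4 × Fin 4 → K),
      (∀ x ∈ V, ∀ (r c : Fin 3 → Fin 4), Function.Injective r → Function.Injective c →
        ((Matrix.of fun i j => x (i, j)).submatrix r c).permanent = 0) →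
      finrank K V = 6 → ∀ c : Fin 2 → K,
      ¬ (∀ u : Fin 4 × Fin 4 → K, ∃ Λ : Fin 2 → ((Fin 4 × Fin 4 → K) →ₗ[K] K),
          ∀ y ∈ V, ∃ e₀ e₁ : K, ∀ s : K,
            eval (u + s • y) (perPoly (Fin 4) K) = e₀ + s * e₁ + s ^ 2 * ∑ k, c k * (Λ k y) ^ 2))
    {m : ℕ} {A : Matrix (Fin m) (Fin m) (MvPolynomial (Fin 4 × Fin 4) K)} (hS : A.IsSymm)
    (hA : IsAffineDetRepr (perPoly (Fin 4) K) A) : 24 ≤ m :=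
  le_of_noSqFamily 24 4 2 (by norm_num) (by norm_num) (by norm_num) H7 H6 hS hA

/-- **`sdc(per_4) ≥ 25 ⟸ H7₅ ∧ H6₃`** — the last size the radical method can reach (at `m = 25`
an `8`-square family on the `8`-dimensional block is no longer excluded by rank). [folklore] -/
theorem twentyFive_le_of
    (H7 : ∀ V : Submodule K (Fin 4 × Fin 4 → K),
      (∀ x ∈ V, ∀ (r c : Fin 3 → Fin 4), Function.Injective r → Function.Injective c →
        ((Matrix.of fun i j => x (i, j)).submatrix r c).permanent = 0) →
      finrank K V = 7 → ∀ c : Fin 5 → K,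
      ¬ (∀ u : Fin 4 × Fin 4 → K, ∃ Λ : Fin 5 → ((Fin 4 × Fin 4 → K) →ₗ[K] K),
          ∀ y ∈ V, ∃ e₀ e₁ : K, ∀ s : K,
            eval (u + s • y) (perPoly (Fin 4) K) = e₀ + s * e₁ + s ^ 2 * ∑ k, c k * (Λ k y) ^ 2))
    (H6 : ∀ V : Submodule K (Fin 4 × Fin 4 → K),
      (∀ x ∈ V, ∀ (r c : Fin 3 → Fin 4), Function.Injective r → Function.Injective c →
        ((Matrix.of fun i j => x (i, j)).submatrix r c).permanent = 0) →
      finrank K V = 6 → ∀ c : Fin 3 → K,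
      ¬ (∀ u : Fin 4 × Fin 4 → K, ∃ Λ : Fin 3 → ((Fin 4 × Fin 4 → K) →ₗ[K] K),
          ∀ y ∈ V, ∃ e₀ e₁ : K, ∀ s : K,
            eval (u + s • y) (perPoly (Fin 4) K) = e₀ + s * e₁ + s ^ 2 * ∑ k, c k * (Λ k y) ^ 2))
    {m : ℕ} {A : Matrix (Fin m) (Fin m) (MvPolynomial (Fin 4 × Fin 4) K)} (hS : A.IsSymm)
    (hA : IsAffineDetRepr (perPoly (Fin 4) K) A) : 25 ≤ m :=
  le_of_noSqFamily 25 5 3 (by norm_num) (by norm_num) (by norm_num) H7 H6 hS hA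

/-- **Inside a block the hypotheses hold**: a `7`-dimensional subspace of a two-row / two-column
block carries no `k`-square family for `k ≤ 5`, and a `6`-dimensional one none for `k ≤ 3`
(`SymPencilPerFourCoordinateRadical.two_mul_finrank_le_card_add_eight_of_sq_family`).  So `H7ₖ`,
`H6ₖ` above only concern subspaces of `Sing Z(per_4)` NOT contained in a block. [folklore] -/
theorem not_sqFamily_of_block {ι : Type*} [Fintype ι] (V : Submodule K (Fin 4 × Fin 4 → K))
    (hV : (∃ a b : Fin 4, a ≠ b ∧ ∀ x ∈ V, ∀ j, x (a, j) = 0 ∧ x (b, j) = 0) ∨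
      (∃ a b : Fin 4, a ≠ b ∧ ∀ x ∈ V, ∀ i, x (i, a) = 0 ∧ x (i, b) = 0))
    (hlt : Fintype.card ι + 8 < 2 * finrank K V) (c : ι → K) :
    ¬ (∀ u : Fin 4 × Fin 4 → K, ∃ Λ : ι → ((Fin 4 × Fin 4 → K) →ₗ[K] K),
        ∀ y ∈ V, ∃ e₀ e₁ : K, ∀ s : K,
          eval (u + s • y) (perPoly (Fin 4) K) = e₀ + s * e₁ + s ^ 2 * ∑ k, c k * (Λ k y) ^ 2) :=
  fun h => not_sq_family_of_card_add_eight_lt V hV hlt fun u => by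
    obtain ⟨Λ, hΛ⟩ := h u
    exact ⟨c, Λ, hΛ⟩

end Summit.ValiantsHypothesis.ValiantsHypothesis.Theorems.SymPencilSdcPerFourLadder

end
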